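/-
Copyright: the b2b-balaban T⁴-continuum CRUX team, row NE7b leaf lineage `t4-ne7b-formalise-leaf-05` (gen 154). Project licence.
-/
import Mathlib.Algebra.Order.BigOperators.Ring.Finset
import Mathlib.Algebra.Order.Chebyshev
import Mathlib.Algebra.BigOperators.Group.Finset.Piecewise
import Mathlib.Data.Real.Basic
import Mathlib.Tactic.Positivity
import Mathlib.Tactic.Linarith
import Mathlib.Tactic.Ring

/-!
# THE COUNTING OF LEMMA CS (iii) ∕ (5.2): a per-plaquette bound «block average of (a sum of `u`-weighted curls) + `ε` × (a sum of `v`-weighted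
# boundary forms)» squares and sums to `Σ_P X(P)² ≤ 2·m₁·u·Σ_q F(q)² + 2·t·m₂·ε²·v·Σ_b A(b)²` — weighted Jensen, Cauchy–Schwarz on the inner
# sums, and exchange of summation against WEIGHTED MULTIPLICITIES `m₁` (fine plaquettes) and `m₂` (fine bonds)
# (row NE7b, node U5c; `HOME/b2b-balaban-r1/SectE-interface-proof.md` §5.2 display (5.2), the (h1) slot of print's `γ₀` assembly; companion of
# `Spine/NE7b/LinearisedLatticeStokes(Rectangle)` — steps (i) ∕ (ii) of Lemma CS — and of `CurlFormEnergyDomination`, which consumes the resulting `(p, q)`)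

Cell `pub-balaban`, sub-cell `t4`, spine estimate NE7b (`T4WeightBudget.RelWeightBound`; the cell's OWN estimate — NOT PRINTED in [Bałaban 1983–89],
NOT PROVED).  Crux-route work under `Spine/NE7b/` by a row leaf; [folklore] finite sums over `ℝ`; NOTHING of Bałaban's is named, asserted or valued; no
`T4Continuum/Support` leaf typed; no `def`; zero `sorry`.  Imports: Mathlib ONLY (fast lane).

WHY (located).  The memo's passage from Lemma CS to (5.2): «Squaring with Jensen (weights `η^d`, total 1) and Cauchy–Schwarz (`Σ_{p∈S_x} η² = 1`;
`Σ_{b∈∂S_x} η = 4`), and counting multiplicities (a fine plaquette lies in `S_x(P)` for at most `4L^{2k}` pairs `(P, x)`; a fine bond lies on `∂S_x(P)` for at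
most `2(d−1)L^k` pairs): `Σ_P |(∂_V M_kA)(P)|² ≤ 8‖D_UA‖² + 32(d−1)c_g²ε_F²‖A‖²`».  This file is that sentence as ONE real inequality over four finite
index types, with the lattice numbers as displayed letters: block weights `w P x ≥ 0` with `Σ_x w P x ≤ 1` (print: `η^d` over `B^k(y_P)`), a uniform
curl weight `u ≥ 0` with `#S(P,x)·u ≤ 1` (print: `η²`, `#S = L^{2k}`), a uniform form weight `v ≥ 0` with `#T(P,x)·v ≤ t` (print: `η`, `t = 4`), and the
WEIGHTED MULTIPLICITIES `Σ_{(P,x) ∋ q} w P x ≤ m₁`, `Σ_{(P,x) ∋ b} w P x ≤ m₂` (print: `4L^{2k}η^d`, `2(d−1)L^kη^d`), so that the constants come out as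
`2m₁u = 8η^d` and `2·t·m₂·v = 16(d−1)η^d` (the memo allows 32) — the `η^d` being the `L²` measure of the fine lattice.  The tree's nearest lemma,
`SqrtFormPerturbationLetters.sum_sq_local_le` (leaf-05 g153: ONE level, unweighted counts `#inc ≤ a`, multiplicity `≤ b`), does not carry the block
average; nothing here restates it.

WHAT IS PROVED ([folklore]):
* §1 `sq_wsum_le` — weighted Jensen without square roots: `0 ≤ w`, `Σ w ≤ 1` ⟹ `(Σ_x w_x c_x)² ≤ Σ_x w_x c_x²`
  (`Finset.sum_sq_le_sum_mul_sum_of_sq_le_mul` with `r = wc`, `f = w`, `g = wc²`); `sq_usum_le` — `#S·u ≤ 1`, `u ≥ 0` ⟹ `(Σ_{q∈S} u·|F q|)² ≤ u·Σ_{q∈S} F q²`;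
  `sq_vsum_le` — `#T·v ≤ t` ⟹ `(Σ_{b∈T} v·|A b|)² ≤ t·v·Σ_{b∈T} A b²` (`sq_sum_le_card_mul_sum_sq`).
* §2 `wsum_sum_mem_le_of_multiplicity` — the exchange: `Σ_P Σ_x w P x · Σ_{q∈S P x} g q ≤ m₁ · Σ_q g q` for `g ≥ 0` under the weighted multiplicity letter.
* §3 **`sum_sq_le_of_blockAverage_bound`** — THE (5.2) COUNTING: from `|X P| ≤ Σ_x w P x·(a P x + ε·Σ_{b∈T P x} v|A b|)`, `0 ≤ a P x ≤ Σ_{q∈S P x} u|F q|`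
  and the letters above, `Σ_P (X P)² ≤ 2·m₁·u·Σ_q (F q)² + 2·t·m₂·ε²·v·Σ_b (A b)²`.
* §4 a two-point toy (non-vacuity of the letters).

NOT HERE (honest): the lattice instance (which `P, X, q, b`, the sets `S_x(P)`, `∂S_x(P)`, the numbers `η, L, k, d`), Lemma CS itself ((i) is
`LinearisedLatticeStokesRectangle.left_hol_rectWord_of_flat` ∕ `sz_rectWord_defect_le`, (ii) `sz_transport_quotient_le`, the reading (R-M) and the size
`c_g ε_F` stay displayed), and the junction with `CurlFormEnergyDomination.h1_of_letters` (whose `(p, q)` this inequality's right side instantiates once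
`F = D_UA` and `A` are read in the `L²(Ω_k)` norms) — (A3) ∕ (A1c), NC-NE7b-α UNRULED.  BY-NAME EFFECT ON THE WALL: NONE.  NE7b NOT PRINTED ∕ NOT
PROVED; spine PROVED 0∕9; rung (B)+1 on a FINITE torus — NOT infinite volume, NOT the mass gap, NOT Clay.
HONEST DEPENDENCY: continuum YM on T⁴ ⇐ BetaPertH ∧ nine spine estimates (0/9 proved); BetaPertH ⇐ (D1) ∧ (D4) ∧ CAP+tail; G-an2-4 gates asym, D1
and NE2/3/4.
-/

set_option autoImplicit false

open scoped BigOperators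
open Finset

namespace Summit.QuantumFields.BalabanUV.T4Continuum.NE7b.CovariantStokesCounting

/-! ## §1 Weighted Jensen and the two inner Cauchy–Schwarz steps -/

section Inner

variable {ι : Type*}

/-- **WEIGHTED JENSEN, square-root free**: `0 ≤ w`, `Σ_{x∈s} w x ≤ 1` ⟹ `(Σ_{x∈s} w x·c x)² ≤ Σ_{x∈s} w x·(c x)²`. [folklore] -/
theorem sq_wsum_le (s : Finset ι) (w c : ι → ℝ) (hw0 : ∀ x ∈ s, 0 ≤ w x) (hw1 : ∑ x ∈ s, w x ≤ 1) :
    (∑ x ∈ s, w x * c x) ^ 2 ≤ ∑ x ∈ s, w x * c x ^ 2 := by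
  have h := Finset.sum_sq_le_sum_mul_sum_of_sq_le_mul s (f := w) (g := fun x => w x * c x ^ 2) (r := fun x => w x * c x)
    hw0 (fun x hx => mul_nonneg (hw0 x hx) (sq_nonneg _)) (fun x _ => by ring_nf; rfl)
  have hg0 : 0 ≤ ∑ x ∈ s, w x * c x ^ 2 := Finset.sum_nonneg fun x hx => mul_nonneg (hw0 x hx) (sq_nonneg _)
  calc (∑ x ∈ s, w x * c x) ^ 2 ≤ (∑ x ∈ s, w x) * ∑ x ∈ s, w x * c x ^ 2 := h
    _ ≤ 1 * ∑ x ∈ s, w x * c x ^ 2 := mul_le_mul_of_nonneg_right hw1 hg0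
    _ = ∑ x ∈ s, w x * c x ^ 2 := one_mul _

/-- **CURL SUMS**: `#S·u ≤ 1`, `u ≥ 0` ⟹ `(Σ_{q∈S} u·|F q|)² ≤ u·Σ_{q∈S} (F q)²` (Cauchy–Schwarz `sq_sum_le_card_mul_sum_sq`; print: `u = η²`, `#S = L^{2k}`).
[folklore] -/
theorem sq_usum_le (S : Finset ι) (F : ι → ℝ) {u : ℝ} (hu : 0 ≤ u) (hS : (S.card : ℝ) * u ≤ 1) :
    (∑ q ∈ S, u * |F q|) ^ 2 ≤ u * ∑ q ∈ S, F q ^ 2 := by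
  have h := sq_sum_le_card_mul_sum_sq (s := S) (f := fun q => u * |F q|)
  have e : ∑ q ∈ S, (u * |F q|) ^ 2 = u * (u * ∑ q ∈ S, F q ^ 2) := by
    rw [Finset.mul_sum, Finset.mul_sum]
    exact Finset.sum_congr rfl fun q _ => by rw [mul_pow, sq_abs]; ring
  have h0 : 0 ≤ u * ∑ q ∈ S, F q ^ 2 := mul_nonneg hu (Finset.sum_nonneg fun q _ => sq_nonneg _)
  calc (∑ q ∈ S, u * |F q|) ^ 2 ≤ (S.card : ℝ) * ∑ q ∈ S, (u * |F q|) ^ 2 := h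
    _ = (S.card : ℝ) * u * (u * ∑ q ∈ S, F q ^ 2) := by rw [e, mul_assoc]
    _ ≤ 1 * (u * ∑ q ∈ S, F q ^ 2) := mul_le_mul_of_nonneg_right hS h0
    _ = u * ∑ q ∈ S, F q ^ 2 := one_mul _

/-- **FORM SUMS**: `#T·v ≤ t` ⟹ `(Σ_{b∈T} v·|A b|)² ≤ t·v·Σ_{b∈T} (A b)²` (print: `v = η`, `#T·v = 4 = t`). [folklore] -/
theorem sq_vsum_le (T : Finset ι) (A : ι → ℝ) {v t : ℝ} (hv : 0 ≤ v) (hT : (T.card : ℝ) * v ≤ t) :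
    (∑ b ∈ T, v * |A b|) ^ 2 ≤ t * v * ∑ b ∈ T, A b ^ 2 := by
  have h := sq_sum_le_card_mul_sum_sq (s := T) (f := fun b => v * |A b|)
  have e : ∑ b ∈ T, (v * |A b|) ^ 2 = v * (v * ∑ b ∈ T, A b ^ 2) := by
    rw [Finset.mul_sum, Finset.mul_sum]
    exact Finset.sum_congr rfl fun b _ => by rw [mul_pow, sq_abs]; ring
  have h0 : 0 ≤ v * ∑ b ∈ T, A b ^ 2 := mul_nonneg hv (Finset.sum_nonneg fun b _ => sq_nonneg _)
  calc (∑ b ∈ T, v * |A b|) ^ 2 ≤ (T.card : ℝ) * ∑ b ∈ T, (v * |A b|) ^ 2 := h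
    _ = (T.card : ℝ) * v * (v * ∑ b ∈ T, A b ^ 2) := by rw [e, mul_assoc]
    _ ≤ t * (v * ∑ b ∈ T, A b ^ 2) := mul_le_mul_of_nonneg_right hT h0
    _ = t * v * ∑ b ∈ T, A b ^ 2 := by ring

end Inner

/-! ## §2 Exchange of summation against a weighted multiplicity -/

section Exchange

variable {P X ι : Type*} [Fintype P] [Fintype X] [Fintype ι] [DecidableEq ι]

/-- **THE EXCHANGE**: if every fine cell `q` is met with total block weight at most `m` — `Σ_P Σ_x [q ∈ S P x]·w P x ≤ m` — then for `g ≥ 0`,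
`Σ_P Σ_x w P x · Σ_{q ∈ S P x} g q ≤ m · Σ_q g q` (print: a fine plaquette lies in `S_x(P)` for `≤ 4L^{2k}` pairs, each of weight `η^d`). [folklore] -/
theorem wsum_sum_mem_le_of_multiplicity (w : P → X → ℝ) (S : P → X → Finset ι) (g : ι → ℝ) (hg : ∀ q, 0 ≤ g q) {m : ℝ}
    (hm : ∀ q, ∑ p, ∑ x, (if q ∈ S p x then w p x else 0) ≤ m) :
    ∑ p, ∑ x, w p x * ∑ q ∈ S p x, g q ≤ m * ∑ q, g q := by
  have e : ∀ p x, w p x * ∑ q ∈ S p x, g q = ∑ q, (if q ∈ S p x then w p x else 0) * g q := by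
    intro p x
    have h1 : ∀ q, (if q ∈ S p x then w p x else 0) * g q = if q ∈ S p x then w p x * g q else 0 := fun q => by
      split_ifs <;> simp
    simp_rw [h1]
    rw [Finset.sum_ite_mem, Finset.univ_inter, Finset.mul_sum]
  calc ∑ p, ∑ x, w p x * ∑ q ∈ S p x, g q = ∑ p, ∑ x, ∑ q, (if q ∈ S p x then w p x else 0) * g q := by
        simp_rw [e]
    _ = ∑ p, ∑ q, ∑ x, (if q ∈ S p x then w p x else 0) * g q := Finset.sum_congr rfl fun p _ => Finset.sum_comm
    _ = ∑ q, ∑ p, ∑ x, (if q ∈ S p x then w p x else 0) * g q := Finset.sum_comm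
    _ = ∑ q, (∑ p, ∑ x, (if q ∈ S p x then w p x else 0)) * g q := by simp_rw [← Finset.sum_mul]
    _ ≤ ∑ q, m * g q := Finset.sum_le_sum fun q _ => mul_le_mul_of_nonneg_right (hm q) (hg q)
    _ = m * ∑ q, g q := (Finset.mul_sum _ _ _).symm

end Exchange

/-! ## §3 The (5.2) counting -/

section Counting

variable {P X Q B : Type*} [Fintype P] [Fintype X] [Fintype Q] [Fintype B] [DecidableEq Q] [DecidableEq B]

/-- **THE COUNTING OF (5.2).**  Block weights `w ≥ 0`, `Σ_x w P x ≤ 1`; curl weight `u ≥ 0` with `#S(P,x)·u ≤ 1`; form weight `v ≥ 0` with `#T(P,x)·v ≤ t`;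
weighted multiplicities `m₁` (cells `q`) and `m₂` (bonds `b`); `t, ε ≥ 0`.  If for every `P`,
`|X P| ≤ Σ_x w P x · (a P x + ε · Σ_{b∈T P x} v·|A b|)` with `0 ≤ a P x ≤ Σ_{q∈S P x} u·|F q|` (Lemma CS with the transported curl sum bounded termwise —
the transports are isometries), then `Σ_P (X P)² ≤ 2·m₁·u·Σ_q (F q)² + 2·t·m₂·ε²·v·Σ_b (A b)²`.  Print's instance: `2m₁u = 8η^d`, `2·t·m₂·v = 16(d−1)η^d`,
i.e. `Σ_P|∂_V M_kA(P)|² ≤ 8‖D_UA‖²_{L²} + 16(d−1)c_g²ε_F²‖A‖²_{L²}` with `ε = c_gε_F`. [folklore] -/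
theorem sum_sq_le_of_blockAverage_bound (w : P → X → ℝ) (S : P → X → Finset Q) (T : P → X → Finset B)
    (Xv : P → ℝ) (a : P → X → ℝ) (F : Q → ℝ) (A : B → ℝ) {u v t ε m₁ m₂ : ℝ}
    (hw0 : ∀ p x, 0 ≤ w p x) (hw1 : ∀ p, ∑ x, w p x ≤ 1) (hu : 0 ≤ u) (hv : 0 ≤ v) (ht : 0 ≤ t) (hε : 0 ≤ ε)
    (hS : ∀ p x, ((S p x).card : ℝ) * u ≤ 1) (hT : ∀ p x, ((T p x).card : ℝ) * v ≤ t)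
    (hm₁ : ∀ q, ∑ p, ∑ x, (if q ∈ S p x then w p x else 0) ≤ m₁)
    (hm₂ : ∀ b, ∑ p, ∑ x, (if b ∈ T p x then w p x else 0) ≤ m₂)
    (ha0 : ∀ p x, 0 ≤ a p x) (ha : ∀ p x, a p x ≤ ∑ q ∈ S p x, u * |F q|)
    (hX : ∀ p, |Xv p| ≤ ∑ x, w p x * (a p x + ε * ∑ b ∈ T p x, v * |A b|)) :
    ∑ p, Xv p ^ 2 ≤ 2 * m₁ * u * ∑ q, F q ^ 2 + 2 * t * m₂ * ε ^ 2 * v * ∑ b, A b ^ 2 := by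
  -- per plaquette: Jensen, then `(a + εβ)² ≤ 2a² + 2ε²β²`, then the two inner Cauchy–Schwarz steps
  have hP : ∀ p, Xv p ^ 2 ≤ ∑ x, w p x * (2 * (u * ∑ q ∈ S p x, F q ^ 2) + 2 * (ε ^ 2 * (t * v * ∑ b ∈ T p x, A b ^ 2))) := by
    intro p
    have hc0 : ∀ x, 0 ≤ a p x + ε * ∑ b ∈ T p x, v * |A b| := fun x =>
      add_nonneg (ha0 p x) (mul_nonneg hε (Finset.sum_nonneg fun b _ => mul_nonneg hv (abs_nonneg _)))
    have h1 : Xv p ^ 2 ≤ (∑ x, w p x * (a p x + ε * ∑ b ∈ T p x, v * |A b|)) ^ 2 := by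
      have h0 : 0 ≤ ∑ x, w p x * (a p x + ε * ∑ b ∈ T p x, v * |A b|) :=
        Finset.sum_nonneg fun x _ => mul_nonneg (hw0 p x) (hc0 x)
      calc Xv p ^ 2 = |Xv p| ^ 2 := (sq_abs _).symm
        _ ≤ _ := pow_le_pow_left₀ (abs_nonneg _) (hX p) 2
    have h2 := sq_wsum_le Finset.univ (w p) (fun x => a p x + ε * ∑ b ∈ T p x, v * |A b|) (fun x _ => hw0 p x) (hw1 p)
    refine h1.trans (h2.trans (Finset.sum_le_sum fun x _ => mul_le_mul_of_nonneg_left ?_ (hw0 p x)))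
    have hA := sq_usum_le (S p x) F hu (hS p x)
    have hB := sq_vsum_le (T p x) A hv (hT p x)
    have hax : a p x ^ 2 ≤ u * ∑ q ∈ S p x, F q ^ 2 :=
      (pow_le_pow_left₀ (ha0 p x) (ha p x) 2).trans hA
    have hbx : (ε * ∑ b ∈ T p x, v * |A b|) ^ 2 ≤ ε ^ 2 * (t * v * ∑ b ∈ T p x, A b ^ 2) := by
      rw [mul_pow]; exact mul_le_mul_of_nonneg_left hB (sq_nonneg _)
    have hsq : ∀ y z : ℝ, (y + z) ^ 2 ≤ 2 * y ^ 2 + 2 * z ^ 2 := fun y z => by nlinarith [sq_nonneg (y - z)]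
    exact (hsq _ _).trans (by linarith)
  -- sum over plaquettes and exchange
  have hF := wsum_sum_mem_le_of_multiplicity w S (fun q => F q ^ 2) (fun q => sq_nonneg _) hm₁
  have hAm := wsum_sum_mem_le_of_multiplicity w T (fun b => A b ^ 2) (fun b => sq_nonneg _) hm₂
  calc ∑ p, Xv p ^ 2 ≤ ∑ p, ∑ x, w p x * (2 * (u * ∑ q ∈ S p x, F q ^ 2) + 2 * (ε ^ 2 * (t * v * ∑ b ∈ T p x, A b ^ 2))) :=
        Finset.sum_le_sum fun p _ => hP p
    _ = 2 * u * (∑ p, ∑ x, w p x * ∑ q ∈ S p x, F q ^ 2) + 2 * ε ^ 2 * t * v * (∑ p, ∑ x, w p x * ∑ b ∈ T p x, A b ^ 2) := by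
        rw [Finset.mul_sum, Finset.mul_sum, ← Finset.sum_add_distrib]
        refine Finset.sum_congr rfl fun p _ => ?_
        rw [Finset.mul_sum, Finset.mul_sum, ← Finset.sum_add_distrib]
        refine Finset.sum_congr rfl fun x _ => ?_
        ring
    _ ≤ 2 * u * (m₁ * ∑ q, F q ^ 2) + 2 * ε ^ 2 * t * v * (m₂ * ∑ b, A b ^ 2) := by
        have h2 : 0 ≤ 2 * u := by positivity
        have h3 : 0 ≤ 2 * ε ^ 2 * t * v := by positivity
        exact add_le_add (mul_le_mul_of_nonneg_left hF h2) (mul_le_mul_of_nonneg_left hAm h3)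
    _ = 2 * m₁ * u * ∑ q, F q ^ 2 + 2 * t * m₂ * ε ^ 2 * v * ∑ b, A b ^ 2 := by ring

end Counting

/-! ## §4 Toy: the letters are jointly satisfiable (one block site, one cell, one bond, `w = u = v = 1`, `t = 1`, multiplicities `1`) -/

example : ∑ _p : Unit, (1 : ℝ) ^ 2 ≤ 2 * 1 * 1 * ∑ _q : Unit, (1 : ℝ) ^ 2 + 2 * 1 * 1 * (0 : ℝ) ^ 2 * 1 * ∑ _b : Unit, (1 : ℝ) ^ 2 :=
  sum_sq_le_of_blockAverage_bound (P := Unit) (X := Unit) (Q := Unit) (B := Unit)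
    (fun _ _ => 1) (fun _ _ => Finset.univ) (fun _ _ => Finset.univ) (fun _ => 1) (fun _ _ => 1) (fun _ => 1) (fun _ => 1)
    (fun _ _ => zero_le_one) (fun _ => by simp) zero_le_one zero_le_one zero_le_one le_rfl (fun _ _ => by simp) (fun _ _ => by simp)
    (fun _ => by simp) (fun _ => by simp) (fun _ _ => zero_le_one) (fun _ _ => by simp) (fun _ => by simp)

end Summit.QuantumFields.BalabanUV.T4Continuum.NE7b.CovariantStokesCounting
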